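import Summits.BirchSwinnertonDyer.BirchSwinnertonDyer.Theorems.TameQuarticManinParityTwistLatticeOrientationOfModThreeSaturation
import Summits.BirchSwinnertonDyer.BirchSwinnertonDyer.Theorems.TameQuarticManinParityTprimeIrrModThreeSaturationOfGaloisFacts
import HarnessLib

/-!
# Route `TameQuarticManinParity`: O22 `TprimeIrrTwistLatticeOrientation` (stmt-BirchSwinnertonDyer-28139) modulo the THREE
# Galois-side named facts only (lead `cruxlead-stmt-BirchSwinnertonDyer-23367` g3, line `abelian-fixed-points`)

O22 ⇐ MS is landed by name (p667893 `tprimeIrrTwistLatticeOrientation_of_tprimeIrrModThreeSaturation`); MS ⇐ (E) ∧ (D) ∧ (61)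
is landed by name (`tprimeIrrModThreeSaturation_of_galoisFacts`, Knapp 11.22 discharged and the H2 branch proved outright).
Composing: `tprimeIrrTwistLatticeOrientation_of_galoisFacts` — O22 holds granted (E) Edixhoven 1992 Thm. 4.5
(`edixhoven1992_serreWeight_le_weight_of_newform`), (D) DDT95 Thm. 3.1(g) (`darmonDiamondTaylor1995_ordinary_of_weightTwo_newform_dvd_level`),
(61) Deligne–Serre 1974 Thm. 6.1 (`DeligneSerre1974.thm61_exists_adicGaloisRep`), and NOTHING ELSE.  CONDITIONAL RESULT;
the item stays open.  THEOREMS ONLY.  No summit is proved; BSD is NOT proved.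
-/

set_option autoImplicit false
-- D-0017: single-problem summit, so `Summit.BirchSwinnertonDyer.BirchSwinnertonDyer.…` repeats a namespace BY DESIGN.
set_option linter.dupNamespace false

noncomputable section

namespace Summit.BirchSwinnertonDyer.BirchSwinnertonDyer.Theorems.TameQuarticManinParity

open Summit.BirchSwinnertonDyer.BirchSwinnertonDyer.Theses.TameQuarticManinParity

/-- **O22 `TprimeIrrTwistLatticeOrientation` (stmt-BirchSwinnertonDyer-28139) modulo exactly (E), (D), (61)**: for a
III-row curve `W` of the tame quartic class with irreducible `ρ̄_{W,3}`, `Λ(D.f) ⊆ g(χ₋₃)·Λ(D.f ⊗ χ₋₃)` — by O22 ⇐ MS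
(p667893) and MS ⇐ (E, D, 61) (`tprimeIrrModThreeSaturation_of_galoisFacts`).  CONDITIONAL RESULT.
[cite: Edixhoven1992, Thm. 4.5] [cite: DarmonDiamondTaylor1995, Thm. 3.1 (g) (p. 86)] [cite: DeligneSerreASENS1974, Thm. 6.1] -/
theorem tprimeIrrTwistLatticeOrientation_of_galoisFacts
    (hE : Literature.NumberTheory.Automorphic.edixhoven1992_serreWeight_le_weight_of_newform)
    (hD : Literature.NumberTheory.Automorphic.darmonDiamondTaylor1995_ordinary_of_weightTwo_newform_dvd_level)
    (h61 : Literature.NumberTheory.EllipticCurves.ModularForms.DeligneSerre1974.thm61_exists_adicGaloisRep) :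
    TprimeIrrTwistLatticeOrientation :=
  tprimeIrrTwistLatticeOrientation_of_tprimeIrrModThreeSaturation (tprimeIrrModThreeSaturation_of_galoisFacts hE hD h61)

end Summit.BirchSwinnertonDyer.BirchSwinnertonDyer.Theorems.TameQuarticManinParity

end
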